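import Summits.SmoothPoincare4.SmoothPoincare4.Theorems.EntropyRungCompactShrinkerGapVolumeCertChunk0to2
import Summits.SmoothPoincare4.SmoothPoincare4.Theorems.EntropyRungCompactShrinkerGapVolumeCertChunk3to5
import Summits.SmoothPoincare4.SmoothPoincare4.Theorems.EntropyRungCompactShrinkerGapVolumeCertChunk6to8
import Summits.SmoothPoincare4.SmoothPoincare4.Theorems.EntropyRungCompactShrinkerGapVolumeCertChunk9to11
import Summits.SmoothPoincare4.SmoothPoincare4.Theorems.EntropyRungCompactShrinkerGapVolumeCertChunk12to14
import Summits.SmoothPoincare4.SmoothPoincare4.Theorems.EntropyRungCompactShrinkerGapVolumeCertChunk15to17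
import Summits.SmoothPoincare4.SmoothPoincare4.Theorems.EntropyRungCompactShrinkerGapVolumeCertChunk18to19
import HarnessLib
/-!
# Volume-comparison certificate for crux `EntropyRung.CompactShrinkerGap` (stmt-SmoothPoincare4-10870), line cgy-variance-pivot — assembly: STUB 22 `stub_volumeCertificate`

STUB 22 `stub_volumeCertificate` of the lead's skeleton v13 (`Cruxes/CompactShrinkerGap/Lines/cgy_variance_pivot.lean`): the pure real-analysis
inequality `Q_B(f,R) := (R−2)² + (38/5)e^{-f} − 2 − (29/20)(R−2) + 149(f−2)e^{-f} − 41((f−R) − (f−2)²)e^{-f} + ½((f−R)(3−R) − (R−2)²)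
+ 142(e^{-f} − 659/5000) ≤ 0` on `0 ≤ R ≤ f ≤ 10` — the rounded dual (β = 2, κ ≤ 38/5) of the level-set LP with members C1, C2, C3, W1, U1 and the
VOLUME-COMPARISON row `E[e^{-f}] ≥ 659/5000` (valid when `Vol ≤ 96π² = Vol S⁴(√6)` and `∫e^{-f} > Z₀`, since `Z₀/96π² = √π e^{-3/2}/3 = 0.131829…`);
exact LP value J*(10) = 1.5235 (J*(15) = 1.84, J*(20) = 2.14). Integrated against `dV` it gives the variance budget under `Vol ≤ 96π² ∧ R ≤ 10`.
Method as in `EntropyRungCompactShrinkerGapLevelSetCertBase.lean` (whose exponential bookkeeping is reused): chunks `f ∈ [k/2,(k+1)/2]`, `k = 0…19`,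
Taylor envelopes for `e^{-f}`, and per chunk two exact Handelman certificates checked by `linarith`. Everything proved; no geometry. [folklore] -/

noncomputable section

namespace Summit.SmoothPoincare4.SmoothPoincare4.Theorems

set_option linter.dupNamespace false
set_option maxHeartbeats 800000
/-- **STUB 22 `stub_volumeCertificate` (line cgy-variance-pivot, skeleton v13)** — the volume-comparison certificate: for all real `f, R`
with `0 ≤ R ≤ f ≤ 10`, `Q_B(f,R) ≤ 0` (numerically `≤ −0.135`). Proof: locate the chunk `k/2 ≤ f ≤ (k+1)/2`, `k = 0,…,19`, and apply its helper
`helper_volCert_chunkK`. [folklore] -/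
theorem stub_volumeCertificate :
    ∀ f R : ℝ, 0 ≤ R → R ≤ f → f ≤ 10 →
      (R - 2) ^ 2 + 38 / 5 * Real.exp (-f) - 2 - 29 / 20 * (R - 2) + 149 * (f - 2) * Real.exp (-f)
          - 41 * ((f - R) - (f - 2) ^ 2) * Real.exp (-f)
          + 1 / 2 * ((f - R) * (3 - R) - (R - 2) ^ 2)
          + 142 * (Real.exp (-f) - 659 / 5000) ≤ 0 := by
  intro f R hR hRf hf
  have hf0 : 0 ≤ f := le_trans hR hRf
  rcases le_total f (1 / 2) with h0 | h0
  · exact helper_volCert_chunk0 f R hf0 h0 hR hRf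
  rcases le_total f (1) with h1 | h1
  · exact helper_volCert_chunk1 f R h0 h1 hR hRf
  rcases le_total f (3 / 2) with h2 | h2
  · exact helper_volCert_chunk2 f R h1 h2 hR hRf
  rcases le_total f (2) with h3 | h3
  · exact helper_volCert_chunk3 f R h2 h3 hR hRf
  rcases le_total f (5 / 2) with h4 | h4
  · exact helper_volCert_chunk4 f R h3 h4 hR hRf
  rcases le_total f (3) with h5 | h5
  · exact helper_volCert_chunk5 f R h4 h5 hR hRf
  rcases le_total f (7 / 2) with h6 | h6
  · exact helper_volCert_chunk6 f R h5 h6 hR hRf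
  rcases le_total f (4) with h7 | h7
  · exact helper_volCert_chunk7 f R h6 h7 hR hRf
  rcases le_total f (9 / 2) with h8 | h8
  · exact helper_volCert_chunk8 f R h7 h8 hR hRf
  rcases le_total f (5) with h9 | h9
  · exact helper_volCert_chunk9 f R h8 h9 hR hRf
  rcases le_total f (11 / 2) with h10 | h10
  · exact helper_volCert_chunk10 f R h9 h10 hR hRf
  rcases le_total f (6) with h11 | h11
  · exact helper_volCert_chunk11 f R h10 h11 hR hRf
  rcases le_total f (13 / 2) with h12 | h12
  · exact helper_volCert_chunk12 f R h11 h12 hR hRf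
  rcases le_total f (7) with h13 | h13
  · exact helper_volCert_chunk13 f R h12 h13 hR hRf
  rcases le_total f (15 / 2) with h14 | h14
  · exact helper_volCert_chunk14 f R h13 h14 hR hRf
  rcases le_total f (8) with h15 | h15
  · exact helper_volCert_chunk15 f R h14 h15 hR hRf
  rcases le_total f (17 / 2) with h16 | h16
  · exact helper_volCert_chunk16 f R h15 h16 hR hRf
  rcases le_total f (9) with h17 | h17
  · exact helper_volCert_chunk17 f R h16 h17 hR hRf
  rcases le_total f (19 / 2) with h18 | h18
  · exact helper_volCert_chunk18 f R h17 h18 hR hRf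
  · exact helper_volCert_chunk19 f R h18 hf hR hRf

end Summit.SmoothPoincare4.SmoothPoincare4.Theorems

end
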